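import Mathlib
import HarnessLib
import Summits.HubbardSuperconductivity.HubbardSuperconductivity.Theorems.KLProgrammeKLRegimeEngineV8PairTransferRelBarIdx

/-!
# Route `KLProgramme` — ENGINE child gen 8 (stmt-HubbardSuperconductivity-20437 `KLRegimeEngineV17F2`), skeleton v2 class #5 «(S)-transfer» rev 3 (RELATIVE family,
# INDEX-keyed bar, plan g21 (R54ab)): SAME-PACKAGE HOSTING of the index bar into `transferBarAt` at an amended geometry package `G.addShellLog C`
# (cell gate-hubbard-kl, seat hubbard-kl-p1 g13 = class-#5 text owner; addendum to `…EngineV8PairTransferRelBarIdx` p590284)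

WHY.  The hosting lemmas of record (k3c1-p1's `transferBarRelAtWF_le_transferBarAt_addShellLog`, p587359; its index form `transferBarRelIdx_le_transferBarAt_addShellLog`,
p590284; the CB bridges of `…SplitGeoShellLogBridge`) host a bar keyed at the UN-AMENDED package `G` into `transferBarAt` at the AMENDED package `G.addShellLog C`.  The
rev-9 image of record, however, keys the class-#5 family AT the amended package itself: stub (c) reads `∀ j ≤ n, PairTransferRelFamilyK5 L M klEngGeo9 P (klCT5 …) β U μ j` with
`klEngGeo9 := klEngGeo8.addShellLog (2^52)` ((R54w)), and step 3 (`pairLadderStepAtV17F2_of_pairTransferPinnedAt`, p581707) wants `PairTransferPinnedAt L M klEngGeo9 P r′ β U μ n (s_{n,n+1})`.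
So the consumer's hosting inequality is needed with the SAME amended package on both sides — the only `G`-dependence of `transferBarRelAtWF` is the thermal slot
`thermalBar G P U β n = G.CF·(KlamU)²·4^{−(n_β−n)}`, larger at `G.addShellLog C` (`CF + 7C`) than at `G`, so this is not a corollary of the un-amended form; the proof is the same
slot-by-slot comparison with the thermal slot matched at the amended package:

* `transferBarRelAtWF_le_transferBarAt_sameShellLog` — for `0 ≤ ms ≤ c`, `ov ≤ c`, `0 ≤ r`, `r·c ≤ r′`, `r·c ≤ r′·C`:
  `transferBarRelAtWF L (G.addShellLog C) P r β U n ms ov ≤ transferBarAt L (G.addShellLog C) P r′ β U n` at every label;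
* `transferBarRelIdx_le_transferBarAt_sameShellLog` — the index bar (`klIdxPrefactor r n ≤ 2r`, weights `≤ 15367`): `2r·15367 ≤ r′`, `2r·15367 ≤ r′·C`;
* `pairTransferPinnedAt_compl_of_relIdx_sameShellLog` — the index clause at the pinned pair `(s_{n,m} | s_{n,n})` of the family keyed AT `G.addShellLog C` gives rev 2's
  `PairTransferPinnedAt L M (G.addShellLog C) P r′ β U μ n (s_{n,m})` (step 3's history input at `m := n+1`; with `G := klEngGeo8`, `C := 2^52` this is the `klEngGeo9` reading).
Real arithmetic over landed lemmas; nothing about the model is asserted.  0 kit · 0 lit.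
-/

noncomputable section

namespace Summit.HubbardSuperconductivity.HubbardSuperconductivity.Theorems.KLRegimeSplit

set_option linter.dupNamespace false -- summit = problem name (single-conjunct summit), D-0017

open Real Finset Literature.MathematicalPhysics.QuantumLattice Literature.Probability.LatticeModels
open Summit.HubbardSuperconductivity.HubbardSuperconductivity.Theorems.KLProgrammeLegKernels
open Summit.HubbardSuperconductivity.HubbardSuperconductivity.Theorems.DispersionFlow

section Hosting

variable {L : ℕ}
set_option maxHeartbeats 400000 in
/-- **SAME-PACKAGE HOSTING**: for weights `0 ≤ ms ≤ c`, `ov ≤ c` and constants `0 ≤ r`, `r·c ≤ r′`, `r·c ≤ r′·C` (`0 ≤ C`, `0 ≤ P.Klam`, `0 ≤ G.CF`, `0 ≤ G.phGain`):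
`transferBarRelAtWF L (G.addShellLog C) P r β U n ms ov Qm k k′ ≤ transferBarAt L (G.addShellLog C) P r′ β U n Qm k k′` — slot by slot: gains and floors into the amended
ph gain `C·(klRelGain + 2^{−n})`, `1/L` and cubic into their namesakes, thermal AT THE AMENDED PACKAGE into thermal at the amended package. -/
theorem transferBarRelAtWF_le_transferBarAt_sameShellLog {G : GeoConsts} (hCF : 0 ≤ G.CF) (hph : ∀ n ρ, 0 ≤ G.phGain n ρ) {P : SplitConsts}
    (hK : 0 ≤ P.Klam) {C c r r' : ℝ} (hC : 0 ≤ C) (hr : 0 ≤ r) (hrc : r * c ≤ r') (hrcC : r * c ≤ r' * C) (β U : ℝ) (n : ℕ) {ms ov : ℝ}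
    (hms0 : 0 ≤ ms) (hms : ms ≤ c) (hov : ov ≤ c) (Qm k k' : TorusSite 2 L) :
    transferBarRelAtWF L (G.addShellLog C) P r β U n ms ov Qm k k' ≤ transferBarAt L (G.addShellLog C) P r' β U n Qm k k' := by
  rw [transferBarRelAtWF_eq]
  unfold transferBarAt
  rw [GeoConsts.addShellLog_phGain, GeoConsts.addShellLog_phGain]
  set ρd := klTorusNorm L (k - k') with hρd
  set ρx := klTorusNorm L (k + k' - Qm) with hρx
  have hρd0 : 0 ≤ ρd := by rw [hρd]; unfold klTorusNorm; exact torusSupNorm_nonneg _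
  have hρx0 : 0 ≤ ρx := by rw [hρx]; unfold klTorusNorm; exact torusSupNorm_nonneg _
  rw [max_eq_left hρd0, max_eq_left hρx0]
  have hgd := klRelGain_nonneg n hρd0
  have hgx := klRelGain_nonneg n hρx0
  have hpd := hph n ρd
  have hpx := hph n ρx
  have hCF' : 0 ≤ (G.addShellLog C).CF := hCF.trans (GeoConsts.CF_le_addShellLog hC)
  have hth0 : 0 ≤ thermalBar (G.addShellLog C) P U β n := by unfold thermalBar; positivity
  have hU2 : 0 ≤ (P.Klam * U) ^ 2 := by positivity
  have hU3 : 0 ≤ (P.Klam * |U|) ^ 3 := by have := mul_nonneg hK (abs_nonneg U); positivity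
  have h2n : 0 < ((2 : ℝ) ^ n)⁻¹ := by positivity
  have h4n : ((4 : ℝ) ^ n)⁻¹ ≤ ((2 : ℝ) ^ n)⁻¹ := by
    refine inv_anti₀ (by positivity) ?_
    exact pow_le_pow_left₀ (by norm_num) (by norm_num) n
  have h4n0 : 0 ≤ ((4 : ℝ) ^ n)⁻¹ := by positivity
  have hL0 : 0 ≤ ((L : ℝ))⁻¹ := by positivity
  have hr' : 0 ≤ r' := le_trans (mul_nonneg hr (le_trans hms0 hms)) hrc
  -- slot by slot (all products of nonnegative quantities)
  have s1 : r * ((P.Klam * U) ^ 2 * (klRelGain n ρd * ms)) ≤ r' * ((P.Klam * U) ^ 2 * (C * klRelGain n ρd)) := by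
    have : r * ms ≤ r' * C := le_trans (mul_le_mul_of_nonneg_left hms hr) hrcC
    nlinarith [mul_nonneg hU2 hgd]
  have s2 : r * ((P.Klam * U) ^ 2 * (klRelGain n ρx * ms)) ≤ r' * ((P.Klam * U) ^ 2 * (C * klRelGain n ρx)) := by
    have : r * ms ≤ r' * C := le_trans (mul_le_mul_of_nonneg_left hms hr) hrcC
    nlinarith [mul_nonneg hU2 hgx]
  have s3 : r * ((P.Klam * U) ^ 2 * (((2 : ℝ) ^ n)⁻¹ * ms)) ≤ r' * ((P.Klam * U) ^ 2 * (C * ((2 : ℝ) ^ n)⁻¹)) := by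
    have : r * ms ≤ r' * C := le_trans (mul_le_mul_of_nonneg_left hms hr) hrcC
    nlinarith [mul_nonneg hU2 h2n.le]
  have s4 : r * ((P.Klam * U) ^ 2 * (((4 : ℝ) ^ n)⁻¹ * ov)) ≤ r' * ((P.Klam * U) ^ 2 * (C * ((2 : ℝ) ^ n)⁻¹)) := by
    have : r * ov ≤ r' * C := le_trans (mul_le_mul_of_nonneg_left hov hr) hrcC
    nlinarith [mul_nonneg hU2 h4n0, mul_nonneg hU2 h2n.le, mul_nonneg (mul_nonneg hr' hC) hU2]
  have s5 : r * ((P.Klam * U) ^ 2 * (((L : ℝ))⁻¹ * ms)) ≤ r' * ((P.Klam * U) ^ 2 * ((L : ℝ))⁻¹) := by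
    have : r * ms ≤ r' := le_trans (mul_le_mul_of_nonneg_left hms hr) hrc
    nlinarith [mul_nonneg hU2 hL0]
  have s6 : r * ((P.Klam * |U|) ^ 3 * ((2 : ℝ) ^ n)⁻¹ * ms) ≤ r' * ((P.Klam * |U|) ^ 3 * ((2 : ℝ) ^ n)⁻¹) := by
    have : r * ms ≤ r' := le_trans (mul_le_mul_of_nonneg_left hms hr) hrc
    nlinarith [mul_nonneg hU3 h2n.le]
  have s7 : r * (thermalBar (G.addShellLog C) P U β n * ms) ≤ r' * thermalBar (G.addShellLog C) P U β n := by
    have : r * ms ≤ r' := le_trans (mul_le_mul_of_nonneg_left hms hr) hrc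
    nlinarith [mul_nonneg hr' hth0]
  have s8 : 0 ≤ r' * ((P.Klam * U) ^ 2 * (G.phGain n ρd + G.phGain n ρx)) := by positivity
  linarith [s1, s2, s3, s4, s5, s6, s7, s8]

/-- **SAME-PACKAGE HOSTING of the index bar**: for `0 ≤ r`, `2r·15367 ≤ r′`, `2r·15367 ≤ r′·C` (`0 ≤ C`, `0 ≤ P.Klam`, `0 ≤ G.CF`, `0 ≤ G.phGain`),
`transferBarRelIdx L (G.addShellLog C) P r β U n m′ ≤ transferBarAt L (G.addShellLog C) P r′ β U n` at every label and every `m′` (`klIdxPrefactor r n ≤ 2r`, index weights `≤ 15367`). -/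
theorem transferBarRelIdx_le_transferBarAt_sameShellLog {G : GeoConsts} (hCF : 0 ≤ G.CF) (hph : ∀ n ρ, 0 ≤ G.phGain n ρ) {P : SplitConsts} (hK : 0 ≤ P.Klam)
    {C r r' : ℝ} (hC : 0 ≤ C) (hr : 0 ≤ r) (hrc : 2 * r * 15367 ≤ r') (hrcC : 2 * r * 15367 ≤ r' * C) (β U : ℝ) (n m' : ℕ) (Qm k k' : TorusSite 2 L) :
    transferBarRelIdx L (G.addShellLog C) P r β U n m' Qm k k' ≤ transferBarAt L (G.addShellLog C) P r' β U n Qm k k' := by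
  rw [transferBarRelIdx_eq]
  have hCF' : 0 ≤ (G.addShellLog C).CF := hCF.trans (GeoConsts.CF_le_addShellLog hC)
  refine (transferBarRelAtWF_mono_r hCF' hK (klIdxPrefactor_le hr n) β U n (klIdxMass_nonneg n m') (klIdxOverlap_nonneg n m') Qm k k').trans ?_
  exact transferBarRelAtWF_le_transferBarAt_sameShellLog hCF hph hK hC (by positivity) hrc hrcC β U n (klIdxMass_nonneg n m') (klIdxMass_le n m')
    (klIdxOverlap_le n m') Qm k k'

variable {M : ℕ} [NeZero L] [NeZero M]

/-- **Step 3's history input when the family is keyed AT the amended package**: the index clause at the PINNED pair `(s_{n,m} | s_{n,n})` of the family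
`PairTransferRelFamilyK5 L M (G.addShellLog C) P r β U μ n` gives rev 2's `PairTransferPinnedAt L M (G.addShellLog C) P r′ β U μ n (s_{n,m})` (`0 ≤ r`, `2r·15367 ≤ r′`,
`2r·15367 ≤ r′·C`; with `G := klEngGeo8`, `C := 2^52` this is the `klEngGeo9` reading of the rev-9 image; step 3 reads `m := n+1`). -/
theorem pairTransferPinnedAt_compl_of_relIdx_sameShellLog {G : GeoConsts} (hCF : 0 ≤ G.CF) (hph : ∀ n ρ, 0 ≤ G.phGain n ρ) {P : SplitConsts} (hK : 0 ≤ P.Klam)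
    {C r r' β U μ : ℝ} (hC : 0 ≤ C) (hr : 0 ≤ r) (hrc : 2 * r * 15367 ≤ r') (hrcC : 2 * r * 15367 ≤ r' * C) {n m : ℕ}
    (h : PairTransferRelAt L M β U μ n (transferBarRelIdx L (G.addShellLog C) P r β U n n)
      (softSymbolCompl L M β μ (klFlowFrameU L M β U μ n) n m) (softSymbolCompl L M β μ (klFlowFrameU L M β U μ n) n n)) :
    PairTransferPinnedAt L M (G.addShellLog C) P r' β U μ n (softSymbolCompl L M β μ (klFlowFrameU L M β U μ n) n m) :=
  pairTransferPinnedAt_compl_of_relIdx_of_le h fun Qm k k' => transferBarRelIdx_le_transferBarAt_sameShellLog hCF hph hK hC hr hrc hrcC β U n n Qm k k'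

end Hosting

end Summit.HubbardSuperconductivity.HubbardSuperconductivity.Theorems.KLRegimeSplit

end
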